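import Summits.QuantumFields.QCD.Theorems.PauliWegnerSeaFMClosureUnquenchedTwoStarC1
import Literature.MathematicalPhysics.QuantumFieldTheory.QCDPhaseQuenchedTranslation
import Literature.MathematicalPhysics.QuantumFieldTheory.QCDHeavyQuarkPropagator
import Literature.MathematicalPhysics.QuantumFieldTheory.QCDPhaseQuenchedMomentUpgrade
import Literature.Probability.LatticeModels.TorusCentredLift
import Literature.Probability.Moments.CrossingSplitTransfer

/-!
# Crux `FMClosureUnquenched` (stmt-QuantumFields-11512), line `von-mises-circles`, stub `stub_closure`:
helper 2 — reductions of the crux's moment and the `pqE` calculus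

* flavour reduction: `cruxMoment N_f β m S f v s = pqE[‖D_f⁻¹(0, v)‖₁^s]` (the same-flavour block of the
  multi-flavour propagator is the one-flavour propagator under the weight `|det 𝔇|`);
* translation invariance of `pqE[‖D_f⁻¹(x, y)‖₁^s]` on the torus (`x, y ↦ 0, y - x`);
* lowering of the exponent of `cruxMoment` (Lyapunov/Jensen under the phase-quenched probability measure)
  and the resulting shell bound `cruxMoment(v, t) ≤ Θ^{-qσ}` from the crux's input `Θ^q · cruxMoment(v, s) ≤ 1`;
* linearity / a.e.-monotonicity of `pqE` and the integrability of one, two and three block-norm factors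
  from clause (T0) of `TwoStarBounds`;
* `CollarResolventBounds` (registered with `let`s) in the vocabulary of the definitions file.

References: Aizenman–Schenker–Friedrich–Hundertmark, CMP 224 (2001) 219, §2 [AizenmanEtAl2001];
Montvay–Münster, *Quantum Fields on a Lattice* (CUP 1994) §5.1 [MontvayMunster1994].
-/

noncomputable section

open scoped BigOperators
open MeasureTheory Filter
open Literature.MathematicalPhysics.QuantumFieldTheory Literature.MathematicalPhysics.QuantumLattice
  Literature.Probability.LatticeModels Literature.Probability.Moments
open Summit.QuantumFields.QCD.Theorems.VonMisesCircles

namespace Summit.QuantumFields.QCD.Theorems.VonMisesCirclesC1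

/-! ## Flavour reduction and translation -/

/-- Under the weight `|det 𝔇(U)|` the same-flavour block norm of the multi-flavour propagator equals the block
norm of the one-flavour propagator `D_f(U)⁻¹` (any power). [folklore] -/
theorem c1_weight_mul_entrySum_rpow_eq {Nf N : ℕ} [NeZero N]
    (U : GaugeConfig 4 N (Matrix.specialUnitaryGroup (Fin 3) ℂ)) (mq : Fin Nf → ℝ) (f : Fin Nf)
    (p q : TorusSite 4 N) (s : ℝ) :
    ‖(diracMatrix U mq).det‖ *
        (∑ a : Fin 3, ∑ i : Fin 4, ∑ b : Fin 3, ∑ j : Fin 4,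
          ‖(diracMatrix U mq)⁻¹ (quarkEquiv (f, (p, a, i))) (quarkEquiv (f, (q, b, j)))‖) ^ s =
      ‖(diracMatrix U mq).det‖ * blockNorm (wilsonD U (mq f))⁻¹ p q ^ s := by
  have h := norm_det_diracMatrix_smul_sameFlavourBlock (S := N) U mq f
    (fun M => (∑ a : Fin 3, ∑ i : Fin 4, ∑ b : Fin 3, ∑ j : Fin 4, ‖M (p, a, i) (q, b, j)‖) ^ s)
  simp only [smul_eq_mul, Matrix.of_apply] at h
  exact h

/-- **Flavour reduction of the crux's moment**: `cruxMoment N_f β m S f v s = pqE[‖D_f⁻¹(proj 0, proj v)‖₁^s]`.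
[folklore] -/
theorem c1_cruxMoment_eq_pqE {Nf : ℕ} (β : ℝ) (mq : Fin Nf → ℝ) (S : ℕ) (f : Fin Nf) (v : Site 4) (s : ℝ) :
    cruxMoment Nf β mq S f v s =
      pqE Nf S β mq (fun U => blockNorm (wilsonD U (mq f))⁻¹
        (Torus.proj (2 * S + 1) 0) (Torus.proj (2 * S + 1) v) ^ s) := by
  have h : (fun U : GaugeConfig 4 (2 * S + 1) (Matrix.specialUnitaryGroup (Fin 3) ℂ) =>
      ‖(diracMatrix U mq).det‖ *
        (∑ a : Fin 3, ∑ i : Fin 4, ∑ b : Fin 3, ∑ j : Fin 4,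
          ‖(diracMatrix U mq)⁻¹ (quarkEquiv (f, (Torus.proj (2 * S + 1) 0, a, i)))
            (quarkEquiv (f, (Torus.proj (2 * S + 1) (v), b, j)))‖) ^ s) =
      fun U => ‖(diracMatrix U mq).det‖ * blockNorm (wilsonD U (mq f))⁻¹
        (Torus.proj (2 * S + 1) 0) (Torus.proj (2 * S + 1) v) ^ s :=
    funext fun U => c1_weight_mul_entrySum_rpow_eq U mq f _ _ s
  unfold cruxMoment pqE
  rw [h]

/-- **Translation invariance** of the phase-quenched block-norm moment on the torus (integer sites).
[folklore] -/
theorem c1_pqE_translate {Nf : ℕ} (β : ℝ) (mq : Fin Nf → ℝ) (S : ℕ) (f : Fin Nf) (s : ℝ) (x y w : Site 4) :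
    pqE Nf S β mq (fun U => blockNorm (wilsonD U (mq f))⁻¹
        (Torus.proj (2 * S + 1) (x + w)) (Torus.proj (2 * S + 1) (y + w)) ^ s) =
      pqE Nf S β mq (fun U => blockNorm (wilsonD U (mq f))⁻¹
        (Torus.proj (2 * S + 1) x) (Torus.proj (2 * S + 1) y) ^ s) := by
  have e : ∀ p q : Site 4, (fun U : GaugeConfig 4 (2 * S + 1) (Matrix.specialUnitaryGroup (Fin 3) ℂ) =>
      ‖(diracMatrix U mq).det‖ * blockNorm (wilsonD U (mq f))⁻¹
        (Torus.proj (2 * S + 1) p) (Torus.proj (2 * S + 1) q) ^ s) =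
      fun U => ‖(diracMatrix U mq).det‖ *
        (∑ a : Fin 3, ∑ i : Fin 4, ∑ b : Fin 3, ∑ j : Fin 4,
          ‖(diracMatrix U mq)⁻¹ (quarkEquiv (f, (Torus.proj (2 * S + 1) p, a, i)))
            (quarkEquiv (f, (Torus.proj (2 * S + 1) q, b, j)))‖) ^ s :=
    fun p q => funext fun U => (c1_weight_mul_entrySum_rpow_eq U mq f _ _ s).symm
  unfold pqE
  rw [e, e, phaseQuenched_twoPoint_translate]

/-- `proj 0 = 0`. [folklore] -/
@[simp] theorem c1_proj_zero (L : ℕ) : Torus.proj L (0 : Site 4) = 0 := by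
  funext i; simp

/-- **Translation invariance, torus sites**: `pqE[‖D_f⁻¹(z, y)‖₁^s] = pqE[‖D_f⁻¹(0, y - z)‖₁^s]`. [folklore] -/
theorem c1_pqE_translate_torus {Nf : ℕ} (β : ℝ) (mq : Fin Nf → ℝ) (S : ℕ) (f : Fin Nf) (s : ℝ)
    (z y : TorusSite 4 (2 * S + 1)) :
    pqE Nf S β mq (fun U => blockNorm (wilsonD U (mq f))⁻¹ z y ^ s) =
      pqE Nf S β mq (fun U => blockNorm (wilsonD U (mq f))⁻¹ 0 (y - z) ^ s) := by
  have h := c1_pqE_translate β mq S f s 0 (Torus.cRep y - Torus.cRep z) (Torus.cRep z)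
  rw [zero_add, sub_add_cancel, Torus.proj_cRep, Torus.proj_cRep, c1_proj_zero, Torus.proj_sub,
    Torus.proj_cRep, Torus.proj_cRep] at h
  exact h

/-! ## Lowering the exponent of the crux's moment -/

/-- The colour–spin entry sum of the multi-flavour propagator to a power `r ∈ [0, 1]` is integrable under the
phase-quenched probability measure. [folklore] -/
theorem c1_integrable_entrySum_rpow {Nf N : ℕ} [NeZero N] (β : ℝ) (mq : Fin Nf → ℝ) (f : Fin Nf)
    (x y : TorusSite 4 N) {r : ℝ} (hr0 : 0 ≤ r) (hr1 : r ≤ 1) :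
    Integrable (fun U : GaugeConfig 4 N (Matrix.specialUnitaryGroup (Fin 3) ℂ) =>
      (∑ a : Fin 3, ∑ i : Fin 4, ∑ b : Fin 3, ∑ j : Fin 4,
        ‖(diracMatrix U mq)⁻¹ (quarkEquiv (f, (x, a, i))) (quarkEquiv (f, (y, b, j)))‖) ^ r)
      (qcdLatticeMeasure N β mq) := by
  haveI := isProbabilityMeasure_qcdLatticeMeasure_all (S := N) β mq
  have hX := integrable_propagatorEntrySum_qcdLatticeMeasure (S := N) β mq
    (integral_norm_det_diracMatrix_pos_all β mq) f x y
  have h0 : ∀ U : GaugeConfig 4 N (Matrix.specialUnitaryGroup (Fin 3) ℂ),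
      0 ≤ ∑ a : Fin 3, ∑ i : Fin 4, ∑ b : Fin 3, ∑ j : Fin 4,
        ‖(diracMatrix U mq)⁻¹ (quarkEquiv (f, (x, a, i))) (quarkEquiv (f, (y, b, j)))‖ := fun U => by
    positivity
  refine Integrable.mono' ((integrable_const (1 : ℝ)).add hX)
    (hX.aestronglyMeasurable.aemeasurable.pow_const r).aestronglyMeasurable
    (Eventually.of_forall fun U => ?_)
  rw [Real.norm_eq_abs, abs_of_nonneg (Real.rpow_nonneg (h0 U) _), Pi.add_apply]
  rcases le_or_gt (∑ a : Fin 3, ∑ i : Fin 4, ∑ b : Fin 3, ∑ j : Fin 4,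
      ‖(diracMatrix U mq)⁻¹ (quarkEquiv (f, (x, a, i))) (quarkEquiv (f, (y, b, j)))‖) 1 with h1 | h1
  · exact (Real.rpow_le_one (h0 U) h1 hr0).trans (by linarith [h0 U])
  · calc _ ≤ _ := Real.rpow_le_rpow_of_exponent_le h1.le hr1
      _ = _ := Real.rpow_one _
      _ ≤ _ := by linarith

/-- **Lyapunov lowering of the exponent**: `cruxMoment(v, t) ≤ cruxMoment(v, s)^{t/s}` for `0 < t ≤ s ≤ 1`.
[folklore] -/
theorem c1_cruxMoment_rpow_le {Nf : ℕ} (β : ℝ) (mq : Fin Nf → ℝ) (S : ℕ) (f : Fin Nf) (v : Site 4)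
    {t s : ℝ} (ht : 0 < t) (hts : t ≤ s) (hs1 : s ≤ 1) :
    cruxMoment Nf β mq S f v t ≤ (cruxMoment Nf β mq S f v s) ^ (t / s) := by
  have h := qcdPhaseQuenchedExpect_rpow_le_rpow (S := 2 * S + 1) β mq
    (integral_norm_det_diracMatrix_pos_all β mq)
    (fun U => ∑ a : Fin 3, ∑ i : Fin 4, ∑ b : Fin 3, ∑ j : Fin 4,
      ‖(diracMatrix U mq)⁻¹ (quarkEquiv (f, (Torus.proj (2 * S + 1) 0, a, i)))
        (quarkEquiv (f, (Torus.proj (2 * S + 1) v, b, j)))‖)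
    (fun U => by positivity) ht hts
    (c1_integrable_entrySum_rpow β mq f _ _ ht.le (hts.trans hs1))
    (c1_integrable_entrySum_rpow β mq f _ _ (ht.le.trans hts) hs1)
  rw [qcdPhaseQuenchedExpect_eq_div, qcdPhaseQuenchedExpect_eq_div] at h
  exact h

/-- `cruxMoment ≥ 0`. [folklore] -/
theorem c1_cruxMoment_nonneg {Nf : ℕ} (β : ℝ) (mq : Fin Nf → ℝ) (S : ℕ) (f : Fin Nf) (v : Site 4) (s : ℝ) :
    0 ≤ cruxMoment Nf β mq S f v s := by
  rw [c1_cruxMoment_eq_pqE]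
  exact pqE_nonneg β mq _ fun U => Real.rpow_nonneg (blockNorm_nonneg _ _ _) _

/-- **The shell input at a lower exponent**: from `ℓ₀^q (1+|β|)^q · cruxMoment(v, s) ≤ 1` and
`0 < t ≤ s ≤ 1`, `σ ≤ t/s`: `cruxMoment(v, t) ≤ (ℓ₀(1+|β|))^{-qσ}`. [folklore] -/
theorem c1_shell_lower {Nf : ℕ} (β : ℝ) (mq : Fin Nf → ℝ) (S : ℕ) (f : Fin Nf) (v : Site 4) (q ℓ₀ : ℕ)
    {t s σ : ℝ} (ht : 0 < t) (hts : t ≤ s) (hs1 : s ≤ 1) (hσ : σ ≤ t / s) (hℓ : 1 ≤ ℓ₀)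
    (h : (ℓ₀ : ℝ) ^ q * (1 + |β|) ^ q * cruxMoment Nf β mq S f v s ≤ 1) :
    cruxMoment Nf β mq S f v t ≤ ((ℓ₀ : ℝ) * (1 + |β|)) ^ (-((q : ℝ) * σ)) := by
  set Θ : ℝ := (ℓ₀ : ℝ) * (1 + |β|) with hΘ
  have hℓ1 : (1 : ℝ) ≤ ℓ₀ := by exact_mod_cast hℓ
  have hΘ1 : 1 ≤ Θ := by
    rw [hΘ]; nlinarith [abs_nonneg β]
  have hΘpos : 0 < Θ := by linarith
  have hpow : (ℓ₀ : ℝ) ^ q * (1 + |β|) ^ q = Θ ^ (q : ℝ) := by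
    rw [hΘ, Real.rpow_natCast, mul_pow]
  have hcm : cruxMoment Nf β mq S f v s ≤ Θ ^ (-(q : ℝ)) := by
    rw [hpow] at h
    rw [Real.rpow_neg hΘpos.le, ← one_div]
    exact (le_div_iff₀' (Real.rpow_pos_of_pos hΘpos _)).2 h
  have hs : 0 < s := ht.trans_le hts
  calc cruxMoment Nf β mq S f v t ≤ (cruxMoment Nf β mq S f v s) ^ (t / s) :=
        c1_cruxMoment_rpow_le β mq S f v ht hts hs1
    _ ≤ (Θ ^ (-(q : ℝ))) ^ (t / s) :=
        Real.rpow_le_rpow (c1_cruxMoment_nonneg β mq S f v s) hcm (div_nonneg ht.le hs.le)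
    _ = Θ ^ (-((q : ℝ) * (t / s))) := by rw [← Real.rpow_mul hΘpos.le]; ring_nf
    _ ≤ Θ ^ (-((q : ℝ) * σ)) := by
        refine Real.rpow_le_rpow_of_exponent_le hΘ1 (neg_le_neg ?_)
        exact mul_le_mul_of_nonneg_left hσ (Nat.cast_nonneg q)

/-! ## The `pqE` calculus -/

section PqE

variable {Nf S : ℕ} (β : ℝ) (mq : Fin Nf → ℝ)

/-- a.e.-monotonicity of `pqE` (the smaller functional non-negative, the larger one with integrable weight).
[folklore] -/
theorem c1_pqE_mono_ae (F G : GaugeConfig 4 (2 * S + 1) (Matrix.specialUnitaryGroup (Fin 3) ℂ) → ℝ)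
    (hF : ∀ U, 0 ≤ F U)
    (hG : Integrable (fun U => ‖(diracMatrix U mq).det‖ * G U) (wilsonMeasure (fundamentalRep (Fin 3)) β))
    (hle : ∀ᵐ U ∂(wilsonMeasure (d := 4) (L := 2 * S + 1) (fundamentalRep (Fin 3)) β), F U ≤ G U) :
    pqE Nf S β mq F ≤ pqE Nf S β mq G := by
  unfold pqE
  refine div_le_div_of_nonneg_right ?_ (integral_nonneg fun _ => norm_nonneg _)
  refine integral_mono_of_nonneg (Eventually.of_forall fun U => mul_nonneg (norm_nonneg _) (hF U)) hG ?_
  filter_upwards [hle] with U hU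
  exact mul_le_mul_of_nonneg_left hU (norm_nonneg _)

/-- `pqE[c F] = c · pqE[F]`. [folklore] -/
theorem c1_pqE_const_mul (c : ℝ) (F : GaugeConfig 4 (2 * S + 1) (Matrix.specialUnitaryGroup (Fin 3) ℂ) → ℝ) :
    pqE Nf S β mq (fun U => c * F U) = c * pqE Nf S β mq F := by
  simp only [pqE]
  rw [← mul_div_assoc, ← integral_const_mul]
  refine congrArg (· / _) (integral_congr_ae (Eventually.of_forall fun U => ?_))
  simp only
  ring

/-- `pqE` of a finite sum of functionals with integrable weights. [folklore] -/
theorem c1_pqE_finset_sum {ι : Type*} (s : Finset ι)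
    (F : ι → GaugeConfig 4 (2 * S + 1) (Matrix.specialUnitaryGroup (Fin 3) ℂ) → ℝ)
    (hF : ∀ i ∈ s, Integrable (fun U => ‖(diracMatrix U mq).det‖ * F i U)
      (wilsonMeasure (fundamentalRep (Fin 3)) β)) :
    pqE Nf S β mq (fun U => ∑ i ∈ s, F i U) = ∑ i ∈ s, pqE Nf S β mq (F i) := by
  unfold pqE
  rw [← Finset.sum_div, ← integral_finsetSum s hF]
  refine congrArg (· / _) (integral_congr_ae (Eventually.of_forall fun U => ?_))
  simp only [Finset.mul_sum]

/-- `pqE[F + G] = pqE[F] + pqE[G]` for integrable weights. [folklore] -/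
theorem c1_pqE_add (F G : GaugeConfig 4 (2 * S + 1) (Matrix.specialUnitaryGroup (Fin 3) ℂ) → ℝ)
    (hF : Integrable (fun U => ‖(diracMatrix U mq).det‖ * F U) (wilsonMeasure (fundamentalRep (Fin 3)) β))
    (hG : Integrable (fun U => ‖(diracMatrix U mq).det‖ * G U) (wilsonMeasure (fundamentalRep (Fin 3)) β)) :
    pqE Nf S β mq (fun U => F U + G U) = pqE Nf S β mq F + pqE Nf S β mq G := by
  unfold pqE
  rw [← add_div, ← integral_add hF hG]
  refine congrArg (· / _) (integral_congr_ae (Eventually.of_forall fun U => ?_))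
  simp only [mul_add]

end PqE

/-! ## Integrability of block-norm products from clause (T0) -/

section T0

variable {Nf S : ℕ} {β s₀ : ℝ} {mq : Fin Nf → ℝ} {f : Fin Nf}

variable (hT0 : ∀ (s₁ s₂ s₃ : ℝ), 0 ≤ s₁ → s₁ ≤ s₀ → 0 ≤ s₂ → s₂ ≤ s₀ → 0 ≤ s₃ → s₃ ≤ s₀ →
      ∀ (A₁ A₂ A₃ : Finset (TorusSite 4 (2 * S + 1))),
        AdmissibleSide S A₁ → AdmissibleSide S A₂ → AdmissibleSide S A₃ →
      ∀ (a₁ b₁ a₂ b₂ a₃ b₃ : TorusSite 4 (2 * S + 1)),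
      Integrable (fun U : GaugeConfig 4 (2 * S + 1) (Matrix.specialUnitaryGroup (Fin 3) ℂ) =>
        ‖(diracMatrix U mq).det‖ *
          (blockNorm (gside A₁ (wilsonD U (mq f))) a₁ b₁ ^ s₁ *
            blockNorm (gside A₂ (wilsonD U (mq f))) a₂ b₂ ^ s₂ *
            blockNorm (gside A₃ (wilsonD U (mq f))) a₃ b₃ ^ s₃))
        (wilsonMeasure (fundamentalRep (Fin 3)) β))

include hT0

/-- Three factors, the middle one the full propagator. [folklore] -/
theorem c1_integrable_three {t : ℝ} (ht0 : 0 ≤ t) (ht : t ≤ s₀) {A₁ A₃ : Finset (TorusSite 4 (2 * S + 1))}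
    (hA₁ : AdmissibleSide S A₁) (hA₃ : AdmissibleSide S A₃) (a₁ b₁ a₂ b₂ a₃ b₃ : TorusSite 4 (2 * S + 1)) :
    Integrable (fun U : GaugeConfig 4 (2 * S + 1) (Matrix.specialUnitaryGroup (Fin 3) ℂ) =>
      ‖(diracMatrix U mq).det‖ *
        (blockNorm (gside A₁ (wilsonD U (mq f))) a₁ b₁ ^ t * blockNorm (wilsonD U (mq f))⁻¹ a₂ b₂ ^ t *
          blockNorm (gside A₃ (wilsonD U (mq f))) a₃ b₃ ^ t))
      (wilsonMeasure (fundamentalRep (Fin 3)) β) := by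
  have h := hT0 t t t ht0 ht ht0 ht ht0 ht A₁ Finset.univ A₃ hA₁ (Or.inl rfl) hA₃ a₁ b₁ a₂ b₂ a₃ b₃
  simp only [gside_univ] at h
  exact h

/-- Two factors, a depleted and a full one. [folklore] -/
theorem c1_integrable_two {t : ℝ} (ht0 : 0 ≤ t) (ht : t ≤ s₀) {A₁ : Finset (TorusSite 4 (2 * S + 1))}
    (hA₁ : AdmissibleSide S A₁) (a₁ b₁ a₂ b₂ : TorusSite 4 (2 * S + 1)) :
    Integrable (fun U : GaugeConfig 4 (2 * S + 1) (Matrix.specialUnitaryGroup (Fin 3) ℂ) =>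
      ‖(diracMatrix U mq).det‖ *
        (blockNorm (gside A₁ (wilsonD U (mq f))) a₁ b₁ ^ t * blockNorm (wilsonD U (mq f))⁻¹ a₂ b₂ ^ t))
      (wilsonMeasure (fundamentalRep (Fin 3)) β) := by
  have hs₀ : 0 ≤ s₀ := ht0.trans ht
  have h := hT0 t t 0 ht0 ht ht0 ht le_rfl hs₀ A₁ Finset.univ Finset.univ hA₁ (Or.inl rfl) (Or.inl rfl)
    a₁ b₁ a₂ b₂ a₂ b₂
  simp only [gside_univ, Real.rpow_zero, mul_one] at h
  exact h

/-- Two depleted factors. [folklore] -/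
theorem c1_integrable_two' {t : ℝ} (ht0 : 0 ≤ t) (ht : t ≤ s₀) {A₁ A₃ : Finset (TorusSite 4 (2 * S + 1))}
    (hA₁ : AdmissibleSide S A₁) (hA₃ : AdmissibleSide S A₃) (a₁ b₁ a₃ b₃ : TorusSite 4 (2 * S + 1)) :
    Integrable (fun U : GaugeConfig 4 (2 * S + 1) (Matrix.specialUnitaryGroup (Fin 3) ℂ) =>
      ‖(diracMatrix U mq).det‖ *
        (blockNorm (gside A₁ (wilsonD U (mq f))) a₁ b₁ ^ t * blockNorm (gside A₃ (wilsonD U (mq f))) a₃ b₃ ^ t))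
      (wilsonMeasure (fundamentalRep (Fin 3)) β) := by
  have hs₀ : 0 ≤ s₀ := ht0.trans ht
  have h := hT0 t 0 t ht0 ht le_rfl hs₀ ht0 ht A₁ Finset.univ A₃ hA₁ (Or.inl rfl) hA₃ a₁ b₁ a₁ b₁ a₃ b₃
  simp only [Real.rpow_zero, mul_one] at h
  exact h

/-- One depleted factor. [folklore] -/
theorem c1_integrable_one {t : ℝ} (ht0 : 0 ≤ t) (ht : t ≤ s₀) {A₁ : Finset (TorusSite 4 (2 * S + 1))}
    (hA₁ : AdmissibleSide S A₁) (a₁ b₁ : TorusSite 4 (2 * S + 1)) :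
    Integrable (fun U : GaugeConfig 4 (2 * S + 1) (Matrix.specialUnitaryGroup (Fin 3) ℂ) =>
      ‖(diracMatrix U mq).det‖ * blockNorm (gside A₁ (wilsonD U (mq f))) a₁ b₁ ^ t)
      (wilsonMeasure (fundamentalRep (Fin 3)) β) := by
  have hs₀ : 0 ≤ s₀ := ht0.trans ht
  have h := hT0 t 0 0 ht0 ht le_rfl hs₀ le_rfl hs₀ A₁ Finset.univ Finset.univ hA₁ (Or.inl rfl) (Or.inl rfl)
    a₁ b₁ a₁ b₁ a₁ b₁
  simp only [Real.rpow_zero, mul_one] at h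
  exact h

/-- One full factor. [folklore] -/
theorem c1_integrable_inv {t : ℝ} (ht0 : 0 ≤ t) (ht : t ≤ s₀) (a b : TorusSite 4 (2 * S + 1)) :
    Integrable (fun U : GaugeConfig 4 (2 * S + 1) (Matrix.specialUnitaryGroup (Fin 3) ℂ) =>
      ‖(diracMatrix U mq).det‖ * blockNorm (wilsonD U (mq f))⁻¹ a b ^ t)
      (wilsonMeasure (fundamentalRep (Fin 3)) β) := by
  have h := c1_integrable_one hT0 ht0 ht (Or.inl rfl) a b
  simp only [gside_univ] at h
  exact h

end T0

/-! ## Subadditivity of fractional powers (`Literature.Probability.Moments.rpow_sum_le_sum_rpow`) -/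

/-- `(c Σ g_i)^t ≤ c^t Σ g_i^t`. [folklore] -/
theorem c1_rpow_const_mul_sum_le {ι : Type*} (T : Finset ι) {c : ℝ} (hc : 0 ≤ c) (g : ι → ℝ)
    (hg : ∀ i ∈ T, 0 ≤ g i) {t : ℝ} (ht0 : 0 < t) (ht1 : t ≤ 1) :
    (c * ∑ i ∈ T, g i) ^ t ≤ c ^ t * ∑ i ∈ T, g i ^ t := by
  rw [Real.mul_rpow hc (Finset.sum_nonneg hg)]
  exact mul_le_mul_of_nonneg_left (rpow_sum_le_sum_rpow T g hg ht0 ht1) (Real.rpow_nonneg hc _)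

/-- Double sums. [folklore] -/
theorem c1_rpow_sum_sum_le {ι κ : Type*} (T : Finset ι) (T' : Finset κ) (g : ι → κ → ℝ)
    (hg : ∀ i j, 0 ≤ g i j) {t : ℝ} (ht0 : 0 < t) (ht1 : t ≤ 1) :
    (∑ i ∈ T, ∑ j ∈ T', g i j) ^ t ≤ ∑ i ∈ T, ∑ j ∈ T', g i j ^ t :=
  (rpow_sum_le_sum_rpow T _ (fun i _ => Finset.sum_nonneg fun j _ => hg i j) ht0 ht1).trans
    (Finset.sum_le_sum fun i _ => rpow_sum_le_sum_rpow T' _ (fun j _ => hg i j) ht0 ht1)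

/-- Quadruple sums. [folklore] -/
theorem c1_rpow_sum4_le {ι₁ ι₂ ι₃ ι₄ : Type*} (T₁ : Finset ι₁) (T₂ : Finset ι₂) (T₃ : Finset ι₃)
    (T₄ : Finset ι₄) (g : ι₁ → ι₂ → ι₃ → ι₄ → ℝ) (hg : ∀ i j k l, 0 ≤ g i j k l) {t : ℝ} (ht0 : 0 < t)
    (ht1 : t ≤ 1) :
    (∑ i ∈ T₁, ∑ j ∈ T₂, ∑ k ∈ T₃, ∑ l ∈ T₄, g i j k l) ^ t ≤
      ∑ i ∈ T₁, ∑ j ∈ T₂, ∑ k ∈ T₃, ∑ l ∈ T₄, g i j k l ^ t :=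
  (c1_rpow_sum_sum_le T₁ T₂ _ (fun i j => Finset.sum_nonneg fun k _ => Finset.sum_nonneg fun l _ => hg i j k l)
    ht0 ht1).trans
    (Finset.sum_le_sum fun i _ => Finset.sum_le_sum fun j _ => c1_rpow_sum_sum_le T₃ T₄ _ (hg i j) ht0 ht1)

/-- The full one-flavour matrix is a.e. invertible, from clause (Tinv) at `A = univ`. [folklore] -/
theorem c1_ae_det_wilsonD_ne_zero {S : ℕ} {β m₀ : ℝ}
    (hTinv : ∀ (A : Finset (TorusSite 4 (2 * S + 1))), AdmissibleSide S A →
      ∀ᵐ U ∂(wilsonMeasure (d := 4) (L := 2 * S + 1) (fundamentalRep (Fin 3)) β),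
        (sideMatrix A (wilsonD U m₀)).det ≠ 0) :
    ∀ᵐ U ∂(wilsonMeasure (d := 4) (L := 2 * S + 1) (fundamentalRep (Fin 3)) β), (wilsonD U m₀).det ≠ 0 := by
  have h := hTinv Finset.univ (Or.inl rfl)
  simp only [sideMatrix_univ] at h
  exact h

/-! ## Collar resolvent bounds in the vocabulary of the definitions file -/

/-- `CollarResolventBounds` (registered with `let`-bound abbreviations) unfolded into `wilsonD`, `blockNorm`,
`sideMatrix`/`gside`, `ball`, `sphere`, `ebox`, `boxIn`, `boxOut` (definitional). [folklore] -/
theorem c1_collar_defs (h : CollarResolventBounds) : ∃ cT : ℝ, 0 < cT ∧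
    ∀ (S : ℕ) (U : GaugeConfig 4 (2 * S + 1) (Matrix.specialUnitaryGroup (Fin 3) ℂ)) (m₀ : ℝ)
      (x : TorusSite 4 (2 * S + 1)),
      (∀ r : ℕ, 1 ≤ r → r + 1 ≤ S → ∀ z : TorusSite 4 (2 * S + 1), z ∉ ball S x r →
        (sideMatrix (ball S x r)ᶜ (wilsonD U m₀)).det ≠ 0 →
          blockNorm (wilsonD U m₀)⁻¹ x z ≤
            cT * ∑ p ∈ sphere S x r, ∑ p' ∈ sphere S x (r + 1),
              blockNorm (wilsonD U m₀)⁻¹ x p * blockNorm (gside (ball S x r)ᶜ (wilsonD U m₀)) p' z) ∧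
      ∀ ℓ : ℕ, 1 ≤ ℓ → ℓ + 2 ≤ S →
        (∀ u : TorusSite 4 (2 * S + 1), u ∈ ebox S x ℓ → (wilsonD U m₀).det ≠ 0 →
          blockNorm (gside (ebox S x ℓ) (wilsonD U m₀)) x u ≤
            blockNorm (wilsonD U m₀)⁻¹ x u +
              cT * ∑ w' ∈ boxOut S x ℓ, ∑ w ∈ boxIn S x ℓ,
                blockNorm (wilsonD U m₀)⁻¹ x w' * blockNorm (gside (ebox S x ℓ) (wilsonD U m₀)) w u) ∧
        (3 * ℓ + 4 ≤ S →
          (∀ v' y : TorusSite 4 (2 * S + 1), v' ∉ ebox S x (3 * ℓ + 2) → y ∉ ebox S x (3 * ℓ + 2) →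
            (wilsonD U m₀).det ≠ 0 →
              blockNorm (gside (ebox S x (3 * ℓ + 2))ᶜ (wilsonD U m₀)) v' y ≤
                blockNorm (wilsonD U m₀)⁻¹ v' y +
                  cT * ∑ w' ∈ boxOut S x (3 * ℓ + 2), ∑ w ∈ boxIn S x (3 * ℓ + 2),
                    blockNorm (gside (ebox S x (3 * ℓ + 2))ᶜ (wilsonD U m₀)) v' w' *
                      blockNorm (wilsonD U m₀)⁻¹ w y) ∧
          (∀ y : TorusSite 4 (2 * S + 1), y ∉ ebox S x (3 * ℓ + 2) →
            (sideMatrix (ebox S x ℓ) (wilsonD U m₀)).det ≠ 0 →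
            (sideMatrix (ebox S x (3 * ℓ + 2))ᶜ (wilsonD U m₀)).det ≠ 0 →
              blockNorm (wilsonD U m₀)⁻¹ x y ≤
                cT ^ 2 * ∑ u ∈ boxIn S x ℓ, ∑ u' ∈ boxOut S x ℓ,
                  ∑ v ∈ boxIn S x (3 * ℓ + 2), ∑ v' ∈ boxOut S x (3 * ℓ + 2),
                    blockNorm (gside (ebox S x ℓ) (wilsonD U m₀)) x u * blockNorm (wilsonD U m₀)⁻¹ u' v *
                      blockNorm (gside (ebox S x (3 * ℓ + 2))ᶜ (wilsonD U m₀)) v' y)) :=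
  h

/-- **Registered helper `c1_closure_aux2` of crux stmt-QuantumFields-11512** (line `von-mises-circles`, stub
`stub_closure`): flavour reduction of the crux's moment to the one-flavour block-norm moment. [folklore] -/
theorem c1_closure_aux2 : ∀ (Nf : ℕ) (β : ℝ) (mq : Fin Nf → ℝ) (S : ℕ) (f : Fin Nf) (v : Literature.Probability.LatticeModels.Site 4) (s : ℝ), cruxMoment Nf β mq S f v s = pqE Nf S β mq (fun U => blockNorm (wilsonD U (mq f))⁻¹ (Torus.proj (2 * S + 1) 0) (Torus.proj (2 * S + 1) v) ^ s) :=
  fun _ β mq S f v s => c1_cruxMoment_eq_pqE β mq S f v s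

end Summit.QuantumFields.QCD.Theorems.VonMisesCirclesC1
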